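import Mathlib
import Summits.Ventures.PercRepro2.CoinChainScQprime

/-!
# (Q′) for the GENERAL AND-switch chain (blind cell PercRepro2, night-2 g25;
proofs/NIGHT2-DARC.md §65)

The pure chain's (Q′) (`pureChain_Qprime`, g24) holds VERBATIM for the general chain
(`a` entered from `ent ⊆ U` surely and from `a'` by the coin), with the coin-closed `R`-law
`R⁰ = ν·chainMix ent ent' 0 c d` as the world-0 law in place of `ν·c`: the world-1 pair is the
OR-tail pair with entries `ent ∪ ent'` (`chainMix_one_eq_union`), so (SC) (`pureChain_SC`), the
ideal FKG and the ideal-below-the-world-1-mean bounds are g24's with `ent ∪ ent'`; the two facts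
about the world-0 law — the ideal mean below the world-0 mean (`chain_ideal_le_global_zero`) and
the CLOSED-GATE one-marker bound `q₀ ≤ q_{rD}` (`chain_closed_om_zero`) — hold because `R⁰` is
log-supermodular (`mixture_lsm`) and the global tilt `ν d` is Holley-above `R⁰`
(`chainMix_zero_cross_d`: `m₀(s) d(t) ≤ m₀(s ∩ t) d(s ∪ t)` from `d ≤ c`, `d` lsm and `(c, d)`
jointly lsm).  Then `qprime_of_sc_alg` closes: **`chain_Qprime`**.
-/

namespace Summit.Ventures.PercRepro2.Coin

open Classical

section GenQprimeLemmas

variable {V : Type*} [DecidableEq V] {R : Type*} [Field R] [LinearOrder R] [IsStrictOrderedRing R]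

omit [LinearOrder R] [IsStrictOrderedRing R] in
/-- The world-1 value of the general chain is the world-1 value of the pure chain with the entry
set `ent ∪ ent'`. -/
lemma chainMix_one_eq_union (ent ent' : Finset V) (c d : Finset V → R) (W : Finset V) :
    chainMix ent ent' 1 c d W = chainMix ∅ (ent ∪ ent') 1 c d W := by
  unfold chainMix chainTheta
  have hno : ¬ ∃ r ∈ (∅ : Finset V), r ∈ W := by simp
  rw [if_neg hno]
  by_cases h0 : ∃ r ∈ ent, r ∈ W
  · have h2 : ∃ r ∈ ent ∪ ent', r ∈ W := by
      obtain ⟨r, hr, hrW⟩ := h0; exact ⟨r, Finset.mem_union_left _ hr, hrW⟩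
    rw [if_pos h0, if_pos h2]
  · by_cases h1 : ∃ r ∈ ent', r ∈ W
    · have h2 : ∃ r ∈ ent ∪ ent', r ∈ W := by
        obtain ⟨r, hr, hrW⟩ := h1; exact ⟨r, Finset.mem_union_right _ hr, hrW⟩
      rw [if_neg h0, if_pos h1, if_pos h2]
    · have h2 : ¬ ∃ r ∈ ent ∪ ent', r ∈ W := by
        rintro ⟨r, hr, hrW⟩
        rcases Finset.mem_union.1 hr with hr | hr
        · exact h0 ⟨r, hr, hrW⟩
        · exact h1 ⟨r, hr, hrW⟩
      rw [if_neg h0, if_neg h1, if_neg h2]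

omit [LinearOrder R] [IsStrictOrderedRing R] in
/-- The coin-closed value `m₀ = chainMix ent ent' 0 c d` is `c` off `ent` and `d` on `ent`. -/
lemma chainMix_zero_eq (ent ent' : Finset V) (c d : Finset V → R) (W : Finset V) :
    chainMix ent ent' 0 c d W = if ∃ r ∈ ent, r ∈ W then d W else c W := by
  unfold chainMix chainTheta
  by_cases h0 : ∃ r ∈ ent, r ∈ W
  · simp [h0]
  · by_cases h1 : ∃ r ∈ ent', r ∈ W
    · simp [h0, h1]
    · simp [h0, h1]

/-- **The global tilt `ν d` is Holley-above the coin-closed law**: `m₀(s) d(t) ≤ m₀(s ∩ t) d(s ∪ t)`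
for `m₀ = chainMix ent ent' 0 c d` (from `d ≤ c`, `d` lsm and `(c, d)` jointly lsm). -/
lemma chainMix_zero_cross_d (ent ent' : Finset V) (c d : Finset V → R)
    (hd0 : ∀ W, 0 ≤ d W) (hdc : ∀ W, d W ≤ c W)
    (hdd : ∀ s t, d s * d t ≤ d (s ∩ t) * d (s ∪ t))
    (hcd : ∀ s t, c s * d t ≤ c (s ∩ t) * d (s ∪ t)) (s t : Finset V) :
    chainMix ent ent' 0 c d s * d t ≤ chainMix ent ent' 0 c d (s ∩ t) * d (s ∪ t) := by
  rw [chainMix_zero_eq, chainMix_zero_eq]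
  by_cases hs : ∃ r ∈ ent, r ∈ s
  · rw [if_pos hs]
    by_cases hst : ∃ r ∈ ent, r ∈ s ∩ t
    · rw [if_pos hst]; exact hdd s t
    · rw [if_neg hst]
      calc d s * d t ≤ c s * d t := mul_le_mul_of_nonneg_right (hdc s) (hd0 t)
        _ ≤ c (s ∩ t) * d (s ∪ t) := hcd s t
  · rw [if_neg hs]
    have hst : ¬ ∃ r ∈ ent, r ∈ s ∩ t := by
      rintro ⟨r, hr, hrst⟩; exact hs ⟨r, hr, (Finset.mem_inter.1 hrst).1⟩
    rw [if_neg hst]; exact hcd s t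

/-- **The closed-gate one-marker bound for the general chain**: the world-0 mean (of
`R⁰ = ν·chainMix ent ent' 0 c d`) is below the world-1 mean on the entered clusters
`D = {W meets ent ∪ ent'}`: `(∑ R⁰ z) · (∑_D ν d) ≤ (∑ R⁰) · (∑_D ν d z)` — through the global
tilt `ν d` (`mean_le_tilt` with `chainMix_zero_cross_d`, then `tilt_upset_mean`). -/
theorem chain_closed_om_zero (U ent ent' : Finset V) (ν c d : Finset V → R)
    (hν0 : ∀ W, 0 ≤ ν W) (hν : ∀ s ⊆ U, ∀ t ⊆ U, ν s * ν t ≤ ν (s ∩ t) * ν (s ∪ t))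
    (hc0 : ∀ W, 0 ≤ c W) (hd0 : ∀ W, 0 ≤ d W) (hdc : ∀ W, d W ≤ c W)
    (hdd : ∀ s t, d s * d t ≤ d (s ∩ t) * d (s ∪ t))
    (hcd : ∀ s t, c s * d t ≤ c (s ∩ t) * d (s ∪ t))
    (z : Finset V → R) (hz0 : ∀ W, 0 ≤ z W) (hzm : ∀ s t, z s ≤ z (s ∪ t)) :
    (∑ W ∈ U.powerset, ν W * chainMix ent ent' 0 c d W * z W) *
      (∑ W ∈ U.powerset.filter (fun W => ∃ r ∈ ent ∪ ent', r ∈ W), ν W * d W) ≤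
    (∑ W ∈ U.powerset, ν W * chainMix ent ent' 0 c d W) *
      (∑ W ∈ U.powerset.filter (fun W => ∃ r ∈ ent ∪ ent', r ∈ W), ν W * d W * z W) := by
  have hm0 : ∀ W, 0 ≤ chainMix ent ent' 0 c d W :=
    chainMix_nonneg ent ent' le_rfl zero_le_one hc0 hd0
  have h1 := mean_le_tilt U ν (chainMix ent ent' 0 c d) d z hν0 hν hm0 hd0
    (chainMix_zero_cross_d ent ent' c d hd0 hdc hdd hcd) hz0 hzm
  have h2 := tilt_upset_mean U (ent ∪ ent') ν d z hν0 hν hd0 hdd hz0 hzm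
  set mM := ∑ W ∈ U.powerset, ν W * chainMix ent ent' 0 c d W with hmM
  set zz := ∑ W ∈ U.powerset, ν W * chainMix ent ent' 0 c d W * z W with hzz
  set r := ∑ W ∈ U.powerset.filter (fun W => ∃ r ∈ ent ∪ ent', r ∈ W), ν W * d W with hr
  set zr := ∑ W ∈ U.powerset.filter (fun W => ∃ r ∈ ent ∪ ent', r ∈ W), ν W * d W * z W with hzr
  set D := ∑ W ∈ U.powerset, ν W * d W with hDdef
  set Dz := ∑ W ∈ U.powerset, ν W * d W * z W with hDzdef
  have hD0 : 0 ≤ D := Finset.sum_nonneg fun W _ => mul_nonneg (hν0 W) (hd0 W)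
  have hr0 : 0 ≤ r := Finset.sum_nonneg fun W _ => mul_nonneg (hν0 W) (hd0 W)
  have hmM0 : 0 ≤ mM := Finset.sum_nonneg fun W _ => mul_nonneg (hν0 W) (hm0 W)
  -- h1 : zz * D ≤ mM * Dz ;  h2 : Dz * r ≤ D * zr
  have hchain : D * (zz * r) ≤ D * (mM * zr) := by
    have e1 := mul_le_mul_of_nonneg_right h1 hr0
    have e2 := mul_le_mul_of_nonneg_left h2 hmM0
    calc D * (zz * r) = (zz * D) * r := by ring
      _ ≤ (mM * Dz) * r := e1
      _ = mM * (Dz * r) := by ring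
      _ ≤ mM * (D * zr) := e2
      _ = D * (mM * zr) := by ring
  rcases eq_or_lt_of_le hD0 with hDz | hDpos
  · have hterm : ∀ W ∈ U.powerset, ν W * d W = 0 := by
      intro W hW
      exact (Finset.sum_eq_zero_iff_of_nonneg (fun W _ => mul_nonneg (hν0 W) (hd0 W))).1
        hDz.symm W hW
    have hr_zero : r = 0 := by
      rw [hr]
      exact Finset.sum_eq_zero fun W hW => hterm W (Finset.mem_filter.1 hW).1
    have hzr_zero : zr = 0 := by
      rw [hzr]
      exact Finset.sum_eq_zero fun W hW => by rw [hterm W (Finset.mem_filter.1 hW).1, zero_mul]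
    rw [hr_zero, hzr_zero]; simp
  · exact le_of_mul_le_mul_left hchain hDpos

/-- **The ideal mean is below the world-0 mean of the general chain**: for the ideal
`I = {W meets neither ent nor ent'}` (where `R⁰ = ν c`) and the log-supermodular law
`R⁰ = ν·chainMix ent ent' 0 c d`: `(∑_I ν c z) · (∑ R⁰) ≤ (∑_I ν c) · (∑ R⁰ z)`. -/
theorem chain_ideal_le_global_zero (U ent ent' : Finset V) (ν c d : Finset V → R)
    (hν0 : ∀ W, 0 ≤ ν W) (hν : ∀ s ⊆ U, ∀ t ⊆ U, ν s * ν t ≤ ν (s ∩ t) * ν (s ∪ t))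
    (hc0 : ∀ W, 0 ≤ c W) (hd0 : ∀ W, 0 ≤ d W) (hdc : ∀ W, d W ≤ c W)
    (hcc : ∀ s t, c s * c t ≤ c (s ∩ t) * c (s ∪ t))
    (hdd : ∀ s t, d s * d t ≤ d (s ∩ t) * d (s ∪ t))
    (hcd : ∀ s t, c s * d t ≤ c (s ∩ t) * d (s ∪ t))
    (hratio : ∀ s t, s ⊆ t → d s * c t ≤ c s * d t)
    (z : Finset V → R) (hz0 : ∀ W, 0 ≤ z W) (hzm : ∀ s t, z s ≤ z (s ∪ t)) :
    (∑ W ∈ U.powerset.filter (fun W => ¬ ∃ r ∈ ent ∪ ent', r ∈ W), ν W * c W * z W) *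
        (∑ W ∈ U.powerset, ν W * chainMix ent ent' 0 c d W) ≤
      (∑ W ∈ U.powerset.filter (fun W => ¬ ∃ r ∈ ent ∪ ent', r ∈ W), ν W * c W) *
        (∑ W ∈ U.powerset, ν W * chainMix ent ent' 0 c d W * z W) := by
  have hm0 : ∀ W, 0 ≤ chainMix ent ent' 0 c d W :=
    chainMix_nonneg ent ent' le_rfl zero_le_one hc0 hd0
  have hmix : ∀ s t, chainMix ent ent' 0 c d s * chainMix ent ent' 0 c d t ≤
      chainMix ent ent' 0 c d (s ∩ t) * chainMix ent ent' 0 c d (s ∪ t) :=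
    mixture_lsm ent ent' 0 le_rfl zero_le_one c d hc0 hd0 hdc hcc hdd hcd hratio
  have h := ideal_le_global U (ent ∪ ent') ν (chainMix ent ent' 0 c d) z hν0 hν hm0 hmix hz0 hzm
  have e1 : ∑ W ∈ U.powerset.filter (fun W => ¬ ∃ r ∈ ent ∪ ent', r ∈ W),
      ν W * chainMix ent ent' 0 c d W * z W =
      ∑ W ∈ U.powerset.filter (fun W => ¬ ∃ r ∈ ent ∪ ent', r ∈ W), ν W * c W * z W :=
    Finset.sum_congr rfl fun W hW => by
      rw [chainMix_of_not_meet ent ent' 0 c d (Finset.mem_filter.1 hW).2]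
  have e2 : ∑ W ∈ U.powerset.filter (fun W => ¬ ∃ r ∈ ent ∪ ent', r ∈ W),
      ν W * chainMix ent ent' 0 c d W =
      ∑ W ∈ U.powerset.filter (fun W => ¬ ∃ r ∈ ent ∪ ent', r ∈ W), ν W * c W :=
    Finset.sum_congr rfl fun W hW => by
      rw [chainMix_of_not_meet ent ent' 0 c d (Finset.mem_filter.1 hW).2]
  rw [e1, e2] at h
  exact h

end GenQprimeLemmas

section GenQprimeMain

variable {V : Type*} [DecidableEq V] {R : Type*} [Field R] [LinearOrder R] [IsStrictOrderedRing R]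

set_option maxHeartbeats 400000 in
/-- **(Q′) FOR THE GENERAL CHAIN**: `a0²·U111 + (b0 − g0)·Δ ≥ 0` with `a` the moments of the
coin-closed law `R⁰ = ν·chainMix ent ent' 0 c d`, `b`, `g` those of the world-1 pair — the
hypothesis `hQ` of `chain_functional_nonneg_of_XA_Qprime`, discharged.  Hypotheses: the head
hypotheses of `chain_world1_nonneg`, `d' ≤ d`, nonnegative increasing markers, positive world
masses and a positive ideal mass. -/
theorem chain_Qprime (U ent ent' : Finset V) (ν c d d' : Finset V → R)
    (hν0 : ∀ W, 0 ≤ ν W) (hν : ∀ s ⊆ U, ∀ t ⊆ U, ν s * ν t ≤ ν (s ∩ t) * ν (s ∪ t))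
    (hc0 : ∀ W, 0 ≤ c W) (hd0 : ∀ W, 0 ≤ d W) (hd'0 : ∀ W, 0 ≤ d' W)
    (hdc : ∀ W, d W ≤ c W) (hd'c : ∀ W, d' W ≤ c W) (hd'd : ∀ W, d' W ≤ d W)
    (hcc : ∀ s t, c s * c t ≤ c (s ∩ t) * c (s ∪ t))
    (hdd : ∀ s t, d s * d t ≤ d (s ∩ t) * d (s ∪ t))
    (hd'd' : ∀ s t, d' s * d' t ≤ d' (s ∩ t) * d' (s ∪ t))
    (hcd : ∀ s t, c s * d t ≤ c (s ∩ t) * d (s ∪ t))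
    (hcd' : ∀ s t, c s * d' t ≤ c (s ∩ t) * d' (s ∪ t))
    (hdd' : ∀ s t, d s * d' t ≤ d (s ∩ t) * d' (s ∪ t))
    (hratio : ∀ s t, s ⊆ t → d s * c t ≤ c s * d t)
    (hratio' : ∀ s t, s ⊆ t → d' s * c t ≤ c s * d' t)
    (x y : Finset V → R) (hx0 : ∀ W, 0 ≤ x W) (hy0 : ∀ W, 0 ≤ y W)
    (hxm : ∀ s t, x s ≤ x (s ∪ t)) (hym : ∀ s t, y s ≤ y (s ∪ t))
    (hpos0 : 0 < ∑ W ∈ U.powerset, ν W * chainMix ent ent' 0 c d W)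
    (hpos1 : 0 < ∑ W ∈ U.powerset, ν W * chainMix ent ent' 1 c d W)
    (hmI : 0 < ∑ W ∈ U.powerset.filter (fun W => ¬ ∃ r ∈ ent ∪ ent', r ∈ W), ν W * c W) :
    0 ≤ (∑ W ∈ U.powerset, ν W * chainMix ent ent' 0 c d W) ^ 2 *
          ((∑ W ∈ U.powerset, ν W * chainMix ent ent' 1 c d W) *
            (∑ W ∈ U.powerset, ν W * chainMix ent ent' 1 c d W) *
            (∑ W ∈ U.powerset, ν W * chainMix ent ent' 1 c d' W * (x W * y W))
          - (∑ W ∈ U.powerset, ν W * chainMix ent ent' 1 c d W) *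
            (∑ W ∈ U.powerset, ν W * chainMix ent ent' 1 c d W * y W) *
            (∑ W ∈ U.powerset, ν W * chainMix ent ent' 1 c d' W * x W)
          - (∑ W ∈ U.powerset, ν W * chainMix ent ent' 1 c d W) *
            (∑ W ∈ U.powerset, ν W * chainMix ent ent' 1 c d W * x W) *
            (∑ W ∈ U.powerset, ν W * chainMix ent ent' 1 c d' W * y W)
          + (∑ W ∈ U.powerset, ν W * chainMix ent ent' 1 c d W * x W) *
            (∑ W ∈ U.powerset, ν W * chainMix ent ent' 1 c d W * y W) *
            (∑ W ∈ U.powerset, ν W * chainMix ent ent' 1 c d' W))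
        + ((∑ W ∈ U.powerset, ν W * chainMix ent ent' 1 c d W) -
            (∑ W ∈ U.powerset, ν W * chainMix ent ent' 1 c d' W)) *
          (((∑ W ∈ U.powerset, ν W * chainMix ent ent' 1 c d W) *
              (∑ W ∈ U.powerset, ν W * chainMix ent ent' 0 c d W * x W)
            - (∑ W ∈ U.powerset, ν W * chainMix ent ent' 0 c d W) *
              (∑ W ∈ U.powerset, ν W * chainMix ent ent' 1 c d W * x W)) *
           ((∑ W ∈ U.powerset, ν W * chainMix ent ent' 1 c d W) *
              (∑ W ∈ U.powerset, ν W * chainMix ent ent' 0 c d W * y W)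
            - (∑ W ∈ U.powerset, ν W * chainMix ent ent' 0 c d W) *
              (∑ W ∈ U.powerset, ν W * chainMix ent ent' 1 c d W * y W))) := by
  -- the world-1 laws are the pure chain's with the entry set `A = ent ∪ ent'`
  have hconv : ∀ W, chainMix ent ent' 1 c d W = chainMix ∅ (ent ∪ ent') 1 c d W :=
    chainMix_one_eq_union ent ent' c d
  have hconv' : ∀ W, chainMix ent ent' 1 c d' W = chainMix ∅ (ent ∪ ent') 1 c d' W :=
    chainMix_one_eq_union ent ent' c d'
  simp only [hconv, hconv'] at hpos1 ⊢
  -- names for the moments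
  set a0 := ∑ W ∈ U.powerset, ν W * chainMix ent ent' 0 c d W with ha0
  set a1 := ∑ W ∈ U.powerset, ν W * chainMix ent ent' 0 c d W * x W with ha1
  set a2 := ∑ W ∈ U.powerset, ν W * chainMix ent ent' 0 c d W * y W with ha2
  set b0 := ∑ W ∈ U.powerset, ν W * chainMix ∅ (ent ∪ ent') 1 c d W with hb0
  set b1 := ∑ W ∈ U.powerset, ν W * chainMix ∅ (ent ∪ ent') 1 c d W * x W with hb1
  set b2 := ∑ W ∈ U.powerset, ν W * chainMix ∅ (ent ∪ ent') 1 c d W * y W with hb2'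
  set g0 := ∑ W ∈ U.powerset, ν W * chainMix ∅ (ent ∪ ent') 1 c d' W with hg0
  set g1 := ∑ W ∈ U.powerset, ν W * chainMix ∅ (ent ∪ ent') 1 c d' W * x W with hg1
  set g2 := ∑ W ∈ U.powerset, ν W * chainMix ∅ (ent ∪ ent') 1 c d' W * y W with hg2
  set g12 := ∑ W ∈ U.powerset, ν W * chainMix ∅ (ent ∪ ent') 1 c d' W * (x W * y W) with hg12
  set m := ∑ W ∈ U.powerset.filter (fun W => ¬ ∃ r ∈ ent ∪ ent', r ∈ W), ν W * c W with hm
  set xI := ∑ W ∈ U.powerset.filter (fun W => ¬ ∃ r ∈ ent ∪ ent', r ∈ W), ν W * c W * x W with hxI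
  set yI := ∑ W ∈ U.powerset.filter (fun W => ¬ ∃ r ∈ ent ∪ ent', r ∈ W), ν W * c W * y W with hyI
  set xyI := ∑ W ∈ U.powerset.filter (fun W => ¬ ∃ r ∈ ent ∪ ent', r ∈ W), ν W * c W * (x W * y W)
    with hxyI
  set r := ∑ W ∈ U.powerset.filter (fun W => ∃ r ∈ ent ∪ ent', r ∈ W), ν W * d W with hr
  set xr := ∑ W ∈ U.powerset.filter (fun W => ∃ r ∈ ent ∪ ent', r ∈ W), ν W * d W * x W with hxr
  set yr := ∑ W ∈ U.powerset.filter (fun W => ∃ r ∈ ent ∪ ent', r ∈ W), ν W * d W * y W with hyr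
  set g := ∑ W ∈ U.powerset.filter (fun W => ∃ r ∈ ent ∪ ent', r ∈ W), ν W * d' W with hg
  set Ip := ∑ W ∈ U.powerset.filter (fun W => ¬ ∃ r ∈ ent ∪ ent', r ∈ W), ν W * c W *
    ((b0 * x W - b1) * (b0 * y W - b2)) with hIpdef
  set Dp := ∑ W ∈ U.powerset.filter (fun W => ∃ r ∈ ent ∪ ent', r ∈ W), ν W * d' W *
    ((b0 * x W - b1) * (b0 * y W - b2)) with hDpdef
  have hsplit : ∀ f : Finset V → R, (∑ W ∈ U.powerset, f W) =
      (∑ W ∈ U.powerset.filter (fun W => ¬ ∃ r ∈ ent ∪ ent', r ∈ W), f W) +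
        (∑ W ∈ U.powerset.filter (fun W => ∃ r ∈ ent ∪ ent', r ∈ W), f W) := by
    intro f; rw [add_comm, Finset.sum_filter_add_sum_filter_not]
  have hmeet : ∀ W : Finset V, (∃ r ∈ ent ∪ ent', r ∈ W) → chainMix ∅ (ent ∪ ent') 1 c d W = d W := by
    intro W hW
    apply chainMix_one_of_meet
    obtain ⟨r', hr', hrW⟩ := hW; exact ⟨r', by simpa using hr', hrW⟩
  have hmeet' : ∀ W : Finset V, (∃ r ∈ ent ∪ ent', r ∈ W) →
      chainMix ∅ (ent ∪ ent') 1 c d' W = d' W := by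
    intro W hW
    apply chainMix_one_of_meet
    obtain ⟨r', hr', hrW⟩ := hW; exact ⟨r', by simpa using hr', hrW⟩
  have hnomeet : ∀ W : Finset V, (¬ ∃ r ∈ ent ∪ ent', r ∈ W) →
      chainMix ∅ (ent ∪ ent') 1 c d W = c W := by
    intro W hW
    apply chainMix_of_not_meet
    rintro ⟨r', hr', hrW⟩; exact hW ⟨r', by simpa using hr', hrW⟩
  have hnomeet' : ∀ W : Finset V, (¬ ∃ r ∈ ent ∪ ent', r ∈ W) →
      chainMix ∅ (ent ∪ ent') 1 c d' W = c W := by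
    intro W hW
    apply chainMix_of_not_meet
    rintro ⟨r', hr', hrW⟩; exact hW ⟨r', by simpa using hr', hrW⟩
  have eb0 : b0 = m + r := by
    rw [hb0, hsplit]
    congr 1
    · exact Finset.sum_congr rfl fun W hW => by rw [hnomeet W (Finset.mem_filter.1 hW).2]
    · exact Finset.sum_congr rfl fun W hW => by rw [hmeet W (Finset.mem_filter.1 hW).2]
  have eb1 : b1 = xI + xr := by
    rw [hb1, hsplit]
    congr 1
    · exact Finset.sum_congr rfl fun W hW => by rw [hnomeet W (Finset.mem_filter.1 hW).2]
    · exact Finset.sum_congr rfl fun W hW => by rw [hmeet W (Finset.mem_filter.1 hW).2]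
  have eb2 : b2 = yI + yr := by
    rw [hb2', hsplit]
    congr 1
    · exact Finset.sum_congr rfl fun W hW => by rw [hnomeet W (Finset.mem_filter.1 hW).2]
    · exact Finset.sum_congr rfl fun W hW => by rw [hmeet W (Finset.mem_filter.1 hW).2]
  have eg0 : g0 = m + g := by
    rw [hg0, hsplit]
    congr 1
    · exact Finset.sum_congr rfl fun W hW => by rw [hnomeet' W (Finset.mem_filter.1 hW).2]
    · exact Finset.sum_congr rfl fun W hW => by rw [hmeet' W (Finset.mem_filter.1 hW).2]
  -- the world-1 functional is the ideal part plus the entered part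
  have eU : b0 * b0 * g12 - b0 * b2 * g1 - b0 * b1 * g2 + b1 * b2 * g0 = Ip + Dp := by
    have e1 : ∑ W ∈ U.powerset, ν W * chainMix ∅ (ent ∪ ent') 1 c d' W *
        ((b0 * x W - b1) * (b0 * y W - b2)) = Ip + Dp := by
      rw [hsplit]
      congr 1
      · exact Finset.sum_congr rfl fun W hW => by rw [hnomeet' W (Finset.mem_filter.1 hW).2]
      · exact Finset.sum_congr rfl fun W hW => by rw [hmeet' W (Finset.mem_filter.1 hW).2]
    rw [← e1, centred_expand]
  -- the ideal part expanded, and FKG on the ideal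
  have eIp : Ip = b0 * b0 * xyI - b0 * b2 * xI - b0 * b1 * yI + b1 * b2 * m := by
    rw [hIpdef, centred_expand]
  have hFKG_I : xI * yI ≤ m * xyI :=
    chain_ideal_fkg U (ent ∪ ent') ν c hν0 hν hc0 hcc x y hx0 hy0 hxm hym
  have hIp : (m * b1 - b0 * xI) * (m * b2 - b0 * yI) ≤ m * Ip := by
    rw [eIp]
    have e : m * (b0 * b0 * xyI - b0 * b2 * xI - b0 * b1 * yI + b1 * b2 * m)
        - (m * b1 - b0 * xI) * (m * b2 - b0 * yI) = b0 * b0 * (m * xyI - xI * yI) := by ring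
    have : 0 ≤ b0 * b0 * (m * xyI - xI * yI) :=
      mul_nonneg (mul_nonneg hpos1.le hpos1.le) (by linarith)
    linarith
  -- the closed-gate one-marker bounds: `r (b0 a − a0 b) ≤ a0 (m b − b0 (·)I)`, from `q₀ ≤ q_{rD}`
  have hmr : 0 ≤ m + r := by rw [← eb0]; exact hpos1.le
  have hOMx : r * (b0 * a1 - a0 * b1) ≤ a0 * (m * b1 - b0 * xI) := by
    have h : a1 * r ≤ a0 * xr :=
      chain_closed_om_zero U ent ent' ν c d hν0 hν hc0 hd0 hdc hdd hcd x hx0 hxm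
    rw [eb0, eb1]
    have e : a0 * (m * (xI + xr) - (m + r) * xI) - r * ((m + r) * a1 - a0 * (xI + xr))
        = (m + r) * (a0 * xr - a1 * r) := by ring
    have : 0 ≤ (m + r) * (a0 * xr - a1 * r) := mul_nonneg hmr (by linarith [h])
    linarith [e, this]
  have hOMy : r * (b0 * a2 - a0 * b2) ≤ a0 * (m * b2 - b0 * yI) := by
    have h : a2 * r ≤ a0 * yr :=
      chain_closed_om_zero U ent ent' ν c d hν0 hν hc0 hd0 hdc hdd hcd y hy0 hym
    rw [eb0, eb2]
    have e : a0 * (m * (yI + yr) - (m + r) * yI) - r * ((m + r) * a2 - a0 * (yI + yr))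
        = (m + r) * (a0 * yr - a2 * r) := by ring
    have : 0 ≤ (m + r) * (a0 * yr - a2 * r) := mul_nonneg hmr (by linarith [h])
    linarith [e, this]
  -- the ideal means below the world-0 and the world-1 means
  have hidx : a0 * xI ≤ m * a1 := by
    have h : xI * a0 ≤ m * a1 :=
      chain_ideal_le_global_zero U ent ent' ν c d hν0 hν hc0 hd0 hdc hcc hdd hcd hratio x hx0 hxm
    rw [mul_comm]; exact h
  have hidy : a0 * yI ≤ m * a2 := by
    have h : yI * a0 ≤ m * a2 :=
      chain_ideal_le_global_zero U ent ent' ν c d hν0 hν hc0 hd0 hdc hcc hdd hcd hratio y hy0 hym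
    rw [mul_comm]; exact h
  have hqx : b0 * xI ≤ m * b1 := by
    have h : xI * r ≤ m * xr :=
      ideal_le_entered_R U (ent ∪ ent') ν c d x hν0 hν hc0 hd0 hcd hx0 hxm
    rw [eb0, eb1]
    calc (m + r) * xI = m * xI + xI * r := by ring
      _ ≤ m * xI + m * xr := by linarith [h]
      _ = m * (xI + xr) := by ring
  have hqy : b0 * yI ≤ m * b2 := by
    have h : yI * r ≤ m * yr :=
      ideal_le_entered_R U (ent ∪ ent') ν c d y hν0 hν hc0 hd0 hcd hy0 hym
    rw [eb0, eb2]
    calc (m + r) * yI = m * yI + yI * r := by ring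
      _ ≤ m * yI + m * yr := by linarith [h]
      _ = m * (yI + yr) := by ring
  -- the entered masses
  have hr0 : 0 ≤ r := Finset.sum_nonneg fun W _ => mul_nonneg (hν0 W) (hd0 W)
  have hg0' : 0 ≤ g := Finset.sum_nonneg fun W _ => mul_nonneg (hν0 W) (hd'0 W)
  have hgr : g ≤ r := Finset.sum_le_sum fun W _ => mul_le_mul_of_nonneg_left (hd'd W) (hν0 W)
  have hDp0 : r = 0 → Dp = 0 := fun hrz =>
    chain_entered_gate_zero U (ent ∪ ent') ν d d' hν0 hd0 hd'0 hd'd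
      (fun W => (b0 * x W - b1) * (b0 * y W - b2)) hrz
  -- (SC) for the world-1 pair with the entry set `ent ∪ ent'`
  have hSC : 0 ≤ r * Dp + g * Ip :=
    pureChain_SC U (ent ∪ ent') ν c d d' hν0 hν hc0 hd0 hd'0 hdc hd'c hd'd hcc hdd hd'd' hcd hcd'
      hdd' hratio hratio' x y hx0 hy0 hxm hym
  -- (Q′)
  have hQ0 := qprime_of_sc_alg a0 a1 a2 b0 b1 b2 m xI yI Ip Dp r g hmI hpos0.le hpos1.le hr0 hgr
    hg0' hSC hDp0 hIp hOMx hOMy hidx hidy hqx hqy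
  rw [← eU] at hQ0
  have e : b0 - g0 = r - g := by rw [eb0, eg0]; ring
  rw [e]
  exact hQ0

end GenQprimeMain

end Summit.Ventures.PercRepro2.Coin
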